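import Summits.CriticalPhenomena.PercolationContinuityZ3.Theorems.Transplant.KNCells2ChainFaceRun
import Summits.CriticalPhenomena.PercolationContinuityZ3.Theorems.Transplant.PlanarCells2Levels
import HarnessLib

/-!
# D″ node, (F) part 11b, PLANAR over the two-unit cells (DPRIME-SCOPE §2 L6′, R1; hp-8 column): the (F) schedule of record
# `ChainPlanar.FaceRun.schedule du pc ℓ1 …` (part 11a) placed in the cells — for a centre footprint `pc` of signed level `lv` and transverse
# offset `cbo` in the cell `x`, numeric FIT conditions (`PCells2.FaceRunFit2`) under which every region lies in the shrunk far rows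
# `farAS x du j`, the last core in the target cube `M (x + du)`, and the first rectangle's footprint in `farAS x du j`; plus the per-contact
# step count `N₂of` with its bracket `17 r∥ ≤ end level ≤ 17 r∥ + s₂`

builds on p205010 (kernel theorem, internal audit signed; external expert review pending) — nothing in this file uses p205010.
Lane `prim-bschramm`, seat `prim-hp-8` (gen 30; L6′ (F) owner); helper file (`--supports stmt-CriticalPhenomena-4575`).  Pure `Site 2`.
* `PCells2.FaceRunFit2`, **`faceRun_region_subset_farAS`**, **`faceRun_core_last_subset_M`**, **`faceRun_firstBox_subset_farAS`**;
* `FaceRun.N₂of` / `N₂of_spec` (the floor choice of the long band's step count).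
[cite: KozmaNitzan2024, §4 Lemma 11 (pp. 22–23: Ω inside the far region, the last face in M), p. 26 (M_v), p. 30 (Step III)]
-/

noncomputable section

namespace Summit.CriticalPhenomena.PercolationContinuityZ3.Theorems

namespace Transplant

open Literature.Probability.Percolation Literature.Probability.LatticeModels
open Literature.Probability.Percolation.KozmaNitzan
open Literature.Probability.Percolation.KozmaNitzan.Cells (oth oth_ne eq_oth_of_ne sgOf sgOf_sign)
open ChainPlanar
open PCells (mem_psBox_iff)

/-! ## §1 The step count of the long band -/

namespace ChainPlanar.FaceRun

/-- **The long band's step count**: `⌊X / s₂⌋` (as a natural number) for the level deficit `X` to the target's near face. [folklore] -/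
def N₂of (s₂ X : ℤ) : ℕ := (X / s₂).toNat

/-- **Bracket of the floor choice**: for `0 < s₂`, `0 ≤ X`: `X < (N₂of s₂ X + 1) · s₂` and `N₂of s₂ X · s₂ ≤ X`. [folklore] -/
theorem N₂of_spec {s₂ X : ℤ} (hs : 0 < s₂) (hX : 0 ≤ X) :
    X < ((N₂of s₂ X : ℕ) + 1 : ℤ) * s₂ ∧ ((N₂of s₂ X : ℕ) : ℤ) * s₂ ≤ X := by
  have h0 : 0 ≤ X / s₂ := Int.ediv_nonneg hX hs.le
  have e : ((N₂of s₂ X : ℕ) : ℤ) = X / s₂ := by rw [N₂of, Int.toNat_of_nonneg h0]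
  rw [e]
  constructor
  · have := Int.lt_ediv_add_one_mul_self X hs
    linarith [this]
  · exact Int.ediv_mul_le X hs.ne'

end ChainPlanar.FaceRun

/-! ## §2 The schedule of record in the two-unit cells -/

namespace PCells2

/-- **FIT of the (F) schedule of record in the cells**: for a centre of signed level `lv` and transverse offset `cbo` in the cell `x`
(direction `du`, face row `j`): the regions stay in `farAS x du j` (bottom `5r∥ + 10 s∥ j + 2`, transverse `5r⊥ − 2`), the last core
lands in `M(x + du)` (levels `[17 r∥, 23 r∥]`, transverse `3 r⊥`), the first rectangle's footprint (half-widths `a₁`) stays in `farAS`.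
[this work] -/
structure FaceRunFit2 (P : PCells2) (du : MDir) (j : ℕ) (lv cbo ℓ1 q'₁ s₁ ρ₁ : ℤ) (R' N₁ WM₁ : ℕ) (s₂ ρ₂ : ℤ) (N₂ WM₂ : ℕ)
    (a₁ : Fin 2 → ℕ) : Prop where
  /-- region `0` starts inside the far rows -/
  hbot : 5 * (P.r du.1 : ℤ) + 10 * P.s du.1 * j + 2 ≤ lv + ℓ1 - (s₁ + 2 * R')
  /-- the regions stay inside the far rows transversally -/
  htr : |cbo| + max ρ₁ ρ₂ ≤ 5 * (P.r (oth du.1) : ℤ) - 2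
  /-- the last core is at least at the near face of `M(x + du)` -/
  hM1 : 17 * (P.r du.1 : ℤ) ≤ lv + ℓ1 + ((N₁ : ℤ) + 1) * s₁ + ((N₂ : ℤ) + 1) * s₂
  /-- the last core is at most at the far face of `M(x + du)` -/
  hM2 : lv + ℓ1 + ((N₁ : ℤ) + 1) * s₁ + ((N₂ : ℤ) + 1) * s₂ ≤ 23 * (P.r du.1 : ℤ)
  /-- the last core stays inside `M(x + du)` transversally -/
  htrM : |cbo| + q'₁ + WM₁ + WM₂ + ((N₁ : ℤ) + N₂ + 2) * R' ≤ 3 * (P.r (oth du.1) : ℤ)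
  /-- the first rectangle's footprint starts inside the far rows -/
  hF1 : 5 * (P.r du.1 : ℤ) + 10 * P.s du.1 * j + 2 ≤ lv - a₁ du.1
  /-- the first rectangle's footprint ends inside the far rows -/
  hF2 : lv + a₁ du.1 ≤ 25 * (P.r du.1 : ℤ) - 1
  /-- the first rectangle's footprint stays inside the far rows transversally -/
  hF3 : |cbo| + a₁ (oth du.1) ≤ 5 * (P.r (oth du.1) : ℤ) - 2

variable {P : PCells2} {x : Site 2} {du : MDir} {j : ℕ} {pc : Site 2} {ℓ1 q'₁ s₁ ρ₁ : ℤ} {R' ℓ₀₁ N₁ WM₁ : ℕ} {Wb₁ : ℕ → ℕ}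
  {s₂ ρ₂ : ℤ} {ℓ₀₂ N₂ WM₂ : ℕ} {Wb₂ : ℕ → ℕ} {a₁ : Fin 2 → ℕ}
  (h : FaceRun.TwoBandOK q'₁ s₁ ρ₁ R' ℓ₀₁ N₁ WM₁ Wb₁ s₂ ρ₂ ℓ₀₂ N₂ WM₂ Wb₂) {ℓ₁₁ ℓ₁₂ : ℕ} (hℓ₁ : 2 * 0 + s₁ + R' ≤ ℓ₁₁)
  (hℓ₂ : 2 * 0 + s₂ + R' ≤ ℓ₁₂)
  (hfit : FaceRunFit2 P du j (P.lev du x pc) (pc (oth du.1) - P.cen x (oth du.1)) ℓ1 q'₁ s₁ ρ₁ R' N₁ WM₁ s₂ ρ₂ N₂ WM₂ a₁)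
include hfit

/-- **Every region of the (F) schedule of record lies in the shrunk far rows `farAS x du j`.** [cite: KozmaNitzan2024, §4 Lemma 11 (p. 22: Ω)] -/
theorem faceRun_region_subset_farAS {k : ℕ} (hk : k ≤ N₁ + 1 + N₂) :
    (FaceRun.schedule du pc ℓ1 h hℓ₁ hℓ₂).region k ⊆ P.farAS x du j := by
  intro y hy
  have h1 := FaceRun.lev_ge_of_mem_region h hℓ₁ hℓ₂ hk hy
  have h2 := FaceRun.lev_le_of_mem_region h hℓ₁ hℓ₂ hk hy
  have h3 := abs_le.1 (FaceRun.trans_le_of_mem_region h hℓ₁ hℓ₂ hk hy)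
  have hbot := hfit.hbot; have htr := hfit.htr; have hM2 := hfit.hM2
  have hcb := le_abs_self (pc (oth du.1) - P.cen x (oth du.1))
  have hcb' := neg_abs_le (pc (oth du.1) - P.cen x (oth du.1))
  have hr1 : (1 : ℤ) ≤ P.r du.1 := by exact_mod_cast P.one_le_r du.1
  rw [P.lev_def] at hbot hM2
  have e : sgOf du * (y du.1 - P.cen x du.1) = sgOf du * (y du.1 - pc du.1) + sgOf du * (pc du.1 - P.cen x du.1) := by ring
  rw [PCells2.farAS, mem_psBox_iff, e]
  refine ⟨⟨by linarith, by linarith⟩, by linarith, by linarith⟩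

/-- **The last core of the (F) schedule of record lies in the target cube `M(x + du)`.** [cite: KozmaNitzan2024, §4 p. 26 (M_v), Lemma 11 (p. 23)] -/
theorem faceRun_core_last_subset_M : (FaceRun.schedule du pc ℓ1 h hℓ₁ hℓ₂).core (N₁ + 1 + N₂ + 1) ⊆ P.M (x + stepVec du) := by
  intro y hy
  obtain ⟨h1, h2⟩ := FaceRun.lev_core_last h hℓ₁ hℓ₂ hy
  have h2' := abs_le.1 h2
  have hM1 := hfit.hM1; have hM2 := hfit.hM2; have htrM := hfit.htrM
  have hcb := le_abs_self (pc (oth du.1) - P.cen x (oth du.1))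
  have hcb' := neg_abs_le (pc (oth du.1) - P.cen x (oth du.1))
  rw [P.lev_def] at hM1 hM2
  rw [PCells2.M, P.mem_abox_iff]
  intro i
  push_cast
  by_cases hi : i = du.1
  · subst hi
    rw [P.cen_add_stepVec_fst]
    rcases sgOf_sign du with hs | hs
    · rw [hs] at h1 hM1 hM2; rw [hs]; constructor <;> linarith
    · rw [hs] at h1 hM1 hM2; rw [hs]; constructor <;> linarith
  · rw [eq_oth_of_ne hi, P.cen_add_stepVec_oth]
    constructor <;> linarith

omit h hℓ₁ hℓ₂ in
/-- **The first rectangle's footprint `pc ± a₁` lies in the shrunk far rows.** [cite: KozmaNitzan2024, §4 p. 30 (Step III)] -/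
theorem faceRun_firstBox_subset_farAS :
    Finset.Icc (pc - fun i => ((a₁ i : ℕ) : ℤ)) (pc + fun i => ((a₁ i : ℕ) : ℤ)) ⊆ P.farAS x du j := by
  intro y hy
  rw [Finset.mem_Icc] at hy
  obtain ⟨hy1, hy2⟩ := hy
  have ha := hy1 du.1; have hb := hy2 du.1; have hc := hy1 (oth du.1); have hd := hy2 (oth du.1)
  simp only [Pi.sub_apply, Pi.add_apply] at ha hb hc hd
  have hF1 := hfit.hF1; have hF2 := hfit.hF2; have hF3 := hfit.hF3
  have hcb := le_abs_self (pc (oth du.1) - P.cen x (oth du.1))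
  have hcb' := neg_abs_le (pc (oth du.1) - P.cen x (oth du.1))
  rw [P.lev_def] at hF1 hF2
  rw [PCells2.farAS, mem_psBox_iff]
  refine ⟨⟨?_, ?_⟩, by linarith, by linarith⟩
  · rcases sgOf_sign du with hs | hs <;> rw [hs] at hF1 hF2 ⊢ <;> linarith
  · rcases sgOf_sign du with hs | hs <;> rw [hs] at hF1 hF2 ⊢ <;> linarith

omit hfit in
/-- **Coordinates of a centre in the `R`-enlarged face row**: signed level within `R` of the face row's planar level `faceL`, transverse
offset at most `2 r⊥ + R`. [folklore] -/
theorem faceRow_range_of_mem (P : PCells2) (x : Site 2) (du : MDir) (j R : ℕ) {pc : Site 2}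
    (hpc : pc ∈ Finset.Icc (P.faceLo x du j - (R : Site 2)) (P.faceHi x du j + (R : Site 2))) :
    P.faceL du.1 j - R ≤ P.lev du x pc ∧ P.lev du x pc ≤ P.faceL du.1 j + R ∧
      |pc (oth du.1) - P.cen x (oth du.1)| ≤ 2 * (P.r (oth du.1) : ℤ) + R := by
  rw [PCells2.faceLo, PCells2.faceHi, sLo_sub _ _ (sgOf_sign du), sHi_add _ _ (sgOf_sign du)] at hpc
  change pc ∈ sBox du.1 (sgOf du) (P.cen x) (P.faceL du.1 j - R) (P.faceL du.1 j + R) (2 * (P.r (oth du.1) : ℤ) + R) at hpc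
  obtain ⟨⟨h1, h2⟩, h3, h4⟩ := (mem_psBox_iff (δ := du)).1 hpc
  rw [P.lev_def]
  exact ⟨h1, h2, abs_le.2 ⟨by linarith, by linarith⟩⟩

end PCells2

end Transplant

end Summit.CriticalPhenomena.PercolationContinuityZ3.Theorems

end
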